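import Summits.ABC.ABC.Theses.CongruentialReceptacle
import Literature.NumberTheory.EllipticCurves.SzpiroSixFifthsProofs
import Literature.NumberTheory.EllipticCurves.SzpiroOfAbcProofs
import Literature.NumberTheory.DiophantineGeometry.MinimalDiscriminantNormProofs

/-!
# Sketch for crux-ideate stmt-ABC-1723 (BalancedFreySzpiro), ideator 1, round 1

Card `szpiro-trace-port` — FIRST LEMMA(S), typed and PROVED here (standard axioms expected):

* `exists_minimal_frey_model_sq_le` : the in-tree global minimal Frey model (B–G 12.5.10,
  `exists_minimal_frey_model`) re-packaged with the discriminant comparison `(abc)² ≤ 2⁸ |Δ(W₀)|`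
  instead of the `c₄` comparison;
* `FreyDeltaSzpiro` : C⁺ of the card — Szpiro's `6+ε` in elementary currency for ALL abc triples
  (Oesterlé's "`abc ≤ rad(abc)^{3+ε}`", squared); no balance hypothesis;
* `freyDeltaSzpiro_of_szpiro` : `SzpiroConjecture → FreyDeltaSzpiro`;
* `balancedFreySzpiro_of_freyDeltaSzpiro`, `balancedFreySzpiro_of_szpiro`,
  `balancedFreySzpiro_of_ABC` : the crux is downstream of the Literature conjecture decl
  `SzpiroConjecture` and of the summit `ABC`; the balance hypotheses are never used.
-/

noncomputable section

open UniqueFactorizationMonoid IsDedekindDomain Real WeierstrassCurve Rat.HeightOneSpectrum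
open Literature.NumberTheory.EllipticCurves Literature.NumberTheory.DiophantineGeometry

namespace Summit.ABC.ABC.Cruxes.BalancedFreySzpiro.SzpiroTracePort

/-- C⁺: Szpiro `6+ε` for every Frey curve, in elementary currency (`2⁸ Δ_min = (abc)²`,
`N ∣ 2¹⁰ rad(abc)`): for all abc triples `(abc)² ≤ C(ε) · rad(abc)^{6+ε}`. -/
def FreyDeltaSzpiro : Prop :=
  ∀ ε : ℝ, 0 < ε → ∃ C : ℝ, ∀ a b c : ℕ, IsABCTriple a b c →
    ((a * b * c : ℕ) : ℝ) ^ 2 ≤ C * ((rad a b c : ℕ) : ℝ) ^ (6 + ε)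

/-- B–G 12.5.10 packaged with the DISCRIMINANT comparison: every abc triple carries a global
minimal integral Frey model `W₀` with `cond ∣ 2¹⁰ rad(abc)` and `(abc)² ≤ 2⁸ |Δ(W₀)|`
((12.17): `Δ = 16 (abc)²`; (12.18): `2⁸ Δ = (abc)²`). -/
theorem exists_minimal_frey_model_sq_le {a b c : ℕ} (h : IsABCTriple a b c) :
    ∃ W₀ : WeierstrassCurve ℤ, (W₀.baseChange ℚ).IsElliptic ∧
      (∀ v : HeightOneSpectrum ℤ, (W₀.baseChange ℚ).IsMinimalAt v) ∧
      (W₀.baseChange ℚ).conductorNorm ℤ ∣ 2 ^ 10 * rad a b c ∧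
      (((a * b * c : ℕ) : ℤ)) ^ 2 ≤ 2 ^ 8 * |W₀.Δ| := by
  have h' := h
  obtain ⟨ha, hb, habc, hcop⟩ := h'
  have hc : 0 < c := by omega
  have habc0 : a * b * c ≠ 0 := by positivity
  by_cases h16 : 16 ∣ a * b * c
  · obtain ⟨A, B, hAB, hA, hB, hprod, _hquad⟩ := exists_arrangement h h16
    have h0 : A * B * (A + B) ≠ 0 := by
      rw [← Int.natAbs_ne_zero, hprod]; exact habc0
    have h4 : 4 ∣ B - A - 1 := by
      have : B - A - 1 = B - (A + 1) := by ring
      rw [this]; exact dvd_sub (dvd_trans (by norm_num) hB) hA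
    have h16' : 16 ∣ A * B := dvd_mul_of_dvd_right hB _
    refine ⟨freyIntModel₂ A B, isElliptic_freyIntModel₂ h0 h4 h16', isMinimalAt_freyIntModel₂ hAB hA hB,
      ?_, ?_⟩
    · rw [rad_def, ← hprod]
      exact (conductorNorm_freyIntModel₂_dvd hAB h0 hA hB).trans (dvd_mul_left _ _)
    · rw [freyIntModel₂_Δ h4 h16']
      obtain ⟨e, he⟩ := h16'
      have he' : A * B / 16 = e := by rw [he]; simp
      have hcast : ((a * b * c : ℕ) : ℤ) ^ 2 = (A * B * (A + B)) ^ 2 := by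
        rw [← hprod, Int.natCast_natAbs, sq_abs]
      rw [he', hcast, abs_of_nonneg (by positivity)]
      have : (A * B * (A + B)) ^ 2 = 2 ^ 8 * (e ^ 2 * (A + B) ^ 2) := by rw [he]; ring
      rw [this]
  · have hab : IsCoprime (a : ℤ) (b : ℤ) := Nat.isCoprime_iff_coprime.mpr hcop
    have hP : (a : ℤ) * b * (a + b) = ((a * b * c : ℕ) : ℤ) := by rw [← habc]; push_cast; ring
    have h0 : (a : ℤ) * b * (a + b) ≠ 0 := by rw [hP]; exact_mod_cast habc0
    have h16' : ¬ (16 : ℤ) ∣ (a : ℤ) * b * (a + b) := by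
      rw [hP]; exact_mod_cast mt Int.natCast_dvd_natCast.mp h16
    refine ⟨freyIntModel a b, isElliptic_freyIntModel h0, isMinimalAt_freyIntModel hab h0 h16', ?_, ?_⟩
    · have := conductorNorm_freyIntModel_dvd hab h0 h16'
      rwa [hP, Int.natAbs_natCast, ← rad_def] at this
    · rw [freyIntModel_Δ, hP, abs_of_nonneg (by positivity)]
      nlinarith [sq_nonneg (((a * b * c : ℕ) : ℤ))]

/-- `SzpiroConjecture → FreyDeltaSzpiro`: read Szpiro's inequality on the minimal Frey model
(`|Δ_min| = |Δ(W₀)|` by `minimalDiscriminantNorm_eq_natAbs_holds`), `N ≤ 2¹⁰ rad`. -/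
theorem freyDeltaSzpiro_of_szpiro (hS : SzpiroConjecture) : FreyDeltaSzpiro := by
  intro ε hε
  obtain ⟨C₁, hC₁⟩ := hS ε hε
  set C : ℝ := max C₁ 1 with hCdef
  have hC0 : 0 ≤ C := zero_le_one.trans (le_max_right _ _)
  refine ⟨2 ^ 8 * C * ((2 : ℝ) ^ 10) ^ (6 + ε), fun a b c h ↦ ?_⟩
  obtain ⟨W₀, hE, hmin, hN, hsq⟩ := exists_minimal_frey_model_sq_le h
  haveI := hE
  have key := hC₁ (W₀.baseChange ℚ)
  rw [minimalDiscriminantNorm_eq_natAbs_holds W₀ (Δ_ne_zero_of_isElliptic_baseChange_int W₀) hmin,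
    Nat.cast_natAbs, Int.cast_abs] at key
  set N : ℝ := (((W₀.baseChange ℚ).conductorNorm ℤ : ℕ) : ℝ) with hNdef
  set R : ℝ := ((rad a b c : ℕ) : ℝ) with hRdef
  have hN0 : 0 ≤ N := by positivity
  have hR0 : 0 ≤ R := by positivity
  have h1 : |(W₀.Δ : ℝ)| ≤ C * N ^ (6 + ε) :=
    key.trans (mul_le_mul_of_nonneg_right (le_max_left _ _) (by positivity))
  have h2 : N ≤ 2 ^ 10 * R := by
    have := Nat.le_of_dvd (mul_pos (by positivity) (by rw [rad_def]; exact Nat.radical_pos _)) hN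
    rw [hNdef, hRdef]; exact_mod_cast this
  have hsq' : ((a * b * c : ℕ) : ℝ) ^ 2 ≤ 2 ^ 8 * |(W₀.Δ : ℝ)| := by exact_mod_cast hsq
  calc ((a * b * c : ℕ) : ℝ) ^ 2 ≤ 2 ^ 8 * |(W₀.Δ : ℝ)| := hsq'
    _ ≤ 2 ^ 8 * (C * N ^ (6 + ε)) := by linarith
    _ ≤ 2 ^ 8 * (C * (2 ^ 10 * R) ^ (6 + ε)) := by gcongr
    _ = (2 ^ 8 * C * ((2 : ℝ) ^ 10) ^ (6 + ε)) * R ^ (6 + ε) := by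
        rw [Real.mul_rpow (by positivity) hR0]; ring

/-- The crux is the trace of `FreyDeltaSzpiro` on the balanced cell (balance unused). -/
theorem balancedFreySzpiro_of_freyDeltaSzpiro (h : FreyDeltaSzpiro) :
    Summit.ABC.ABC.Theses.CongruentialReceptacle.BalancedFreySzpiro := by
  intro κ _ ε hε
  obtain ⟨C, hC⟩ := h ε hε
  exact ⟨C, fun a b c habc _ _ ↦ hC a b c habc⟩

/-- `SzpiroConjecture → BalancedFreySzpiro`. -/
theorem balancedFreySzpiro_of_szpiro (hS : SzpiroConjecture) :
    Summit.ABC.ABC.Theses.CongruentialReceptacle.BalancedFreySzpiro :=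
  balancedFreySzpiro_of_freyDeltaSzpiro (freyDeltaSzpiro_of_szpiro hS)

/-- `ABC → BalancedFreySzpiro` (the crux is not stronger than the summit), via the in-tree
`szpiro_of_abcLe_holds` (Silverman VIII.11.5(b) / B–G 12.5.12). -/
theorem balancedFreySzpiro_of_ABC (hABC : _root_.ABC) :
    Summit.ABC.ABC.Theses.CongruentialReceptacle.BalancedFreySzpiro := by
  refine balancedFreySzpiro_of_szpiro (szpiro_of_abcLe_holds ?_)
  intro ε hε
  obtain ⟨C, _hC0, hC⟩ := hABC ε hε
  exact ⟨C, fun a b c h ↦ (hC a b c h).le⟩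

end Summit.ABC.ABC.Cruxes.BalancedFreySzpiro.SzpiroTracePort

end
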